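import Summits.AtomisticToContinuum.HydrodynamicLimit.Theses.ImplosionDichotomy
import Literature.Analysis.FluidPDE.HardSphereCollisionRecord

/-!
# Sketch — crux-ideate stmt-AtomisticToContinuum-17372 (`HydroLimitProfilewiseBand`), ideator 2, round 1

Card `kato-margin-odd-contact-defect`.  First lemmas of the line:

* §1 `sup_le_div_of_margin` — the ABSORPTION step (Kato margin), PROVED: a function dominated by
  `a + κ · (its own running sup)` with `κ < 1` is bounded by `a / (1 - κ)`.
* §2 `LinearDecayComparison` — the linear ODE comparison feeding §1 (statement).
* §3 `meanOneBodyMarginal`, `MeanMarginalEntropyBound` — the free a-priori fact on the mean one-body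
  marginal along the true flow (statement over `lawAt` / `localGibbsLaw` / `klDiv`).
* §5 `meanEntropy`, `MeanEntropyCeiling`, `int_prod_le_of_margin` (PROVED), `DefectProductionMarginShape` —
  consumer B: the free H-budget of the mean marginal over `ν_N t → ∞` mean free times and the production-units
  margin (the J-odd channel cancels at most a fixed fraction of Boltzmann's production).
* §4 `markJ`, `meanCollisionStat`, `eulerOneBody`, `meanDev`, `ContactDefectMarginShape` — the shape of the
  crux input of the line (J-odd incoming contact defect of the MEAN dynamics bounded by a ratio `κ < 1` of the
  running one-body deviation from the Euler local Maxwellian), over `collisionSum` /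
  `HardSphereCollisionRecord.mark` / `reflectVel` / `lawAt` / `klDiv` / `localMaxwellian`; the chaotic-reference
  functional, the gap constant and the mark weight are parameters here and are fixed by the crux-plan seat.
-/

noncomputable section

open MeasureTheory Set Filter Topology
open scoped ENNReal

namespace Summit.AtomisticToContinuum.HydrodynamicLimit.Cruxes.HydroLimitProfilewiseBand.Ideator2

open Literature.MathematicalPhysics.KineticTheory Literature.Analysis.FluidPDE

/-! ## §1 Absorption (Kato margin) — proved -/

/-- **Absorption lemma.** If `f s ≤ a + κ · sup_{[0,s]} f` on `[0,S]` with `0 ≤ κ < 1` (and the image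
of `[0,S]` is bounded above), then `f ≤ a / (1 - κ)` on `[0,S]`.  This is the step that turns a RATIO
bound on the contact defect (margin `κ` below the gap) into an absolute bound on the one-body deviation. -/
theorem sup_le_div_of_margin {f : ℝ → ℝ} {S a κ : ℝ} (hS : 0 ≤ S) (hκ₀ : 0 ≤ κ) (hκ : κ < 1)
    (hbdd : BddAbove (f '' Icc 0 S))
    (h : ∀ s ∈ Icc 0 S, f s ≤ a + κ * sSup (f '' Icc 0 s)) :
    ∀ s ∈ Icc 0 S, f s ≤ a / (1 - κ) := by
  have h0 : (0 : ℝ) ∈ Icc 0 S := ⟨le_rfl, hS⟩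
  have hne : (f '' Icc 0 S).Nonempty := ⟨f 0, mem_image_of_mem f h0⟩
  set m := sSup (f '' Icc 0 S) with hm
  -- every value is below `a + κ m`
  have hstep : ∀ s ∈ Icc 0 S, f s ≤ a + κ * m := by
    intro s hs
    have hsub : f '' Icc 0 s ⊆ f '' Icc 0 S := image_mono (Icc_subset_Icc le_rfl hs.2)
    have hne' : (f '' Icc 0 s).Nonempty := ⟨f 0, mem_image_of_mem f ⟨le_rfl, hs.1⟩⟩
    have hsup : sSup (f '' Icc 0 s) ≤ m := csSup_le_csSup hbdd hne' hsub
    calc f s ≤ a + κ * sSup (f '' Icc 0 s) := h s hs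
      _ ≤ a + κ * m := by gcongr
  -- hence the sup itself is below `a + κ m`
  have hm_le : m ≤ a + κ * m := by
    refine csSup_le hne ?_
    rintro y ⟨s, hs, rfl⟩
    exact hstep s hs
  have h1κ : 0 < 1 - κ := sub_pos.mpr hκ
  have hm_bound : m ≤ a / (1 - κ) := by
    rw [le_div_iff₀ h1κ]
    nlinarith
  intro s hs
  exact (le_csSup hbdd (mem_image_of_mem f hs)).trans hm_bound

/-! ## §2 Linear decay comparison (statement) -/

/-- **Linear decay comparison** (standard ODE comparison, to be proved from Mathlib's Grönwall API):
if `z ≥ 0` is continuous on `[0,S]`, `z 0 = 0`, and `z' ≤ -g z + b + e` on `[0,S)` with `g > 0`, then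
`z s ≤ (b + sup_{[0,s]} e) / g` on `[0,S]`.  Combined with §1 (when `e s ≤ κ g · sup_{[0,s]} z + ε`)
it yields `sup z ≤ (b + ε) / (g (1 - κ))` — the one-body deviation stays `O(Kn + ε_N)`. -/
def LinearDecayComparison : Prop :=
  ∀ (z e : ℝ → ℝ) (S g b : ℝ), 0 ≤ S → 0 < g → 0 ≤ b →
    ContinuousOn z (Icc 0 S) → z 0 = 0 → (∀ s ∈ Icc 0 S, 0 ≤ z s) →
    BddAbove (e '' Icc 0 S) →
    (∀ s ∈ Ico 0 S, ∃ z' : ℝ, HasDerivWithinAt z z' (Ici s) s ∧ z' ≤ -g * z s + b + e s) →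
    ∀ s ∈ Icc 0 S, z s ≤ (b + sSup (e '' Icc 0 s)) / g

/-! ## §3 The mean one-body marginal along the true flow and its free entropy bound -/

variable (σ : ℝ) (a₀ θ₀ : T3 → ℝ) (u₀ : T3 → V3)

/-- Hard-sphere flow families at reduced density `σ` (the crux's `Φ`). -/
abbrev Flows : Type :=
  (N : ℕ) → HardSphereFlow (Torus.geometry (Fin 3)) (hsDiameter σ N) (N + 1)

/-- The **mean one-body marginal** at macroscopic time `s`: the law of particle `0` under the local
Gibbs law transported by the flow (= the expected empirical measure, by exchangeability). -/
def meanOneBodyMarginal (Φ : Flows σ) (N : ℕ) (s : ℝ) : Measure (T3 × V3) :=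
  ((Φ N).lawAt (localGibbsLaw σ a₀ u₀ θ₀ N (Φ N)) s).map (fun z => z 0)

/-- Reference one-body law: uniform positions times the Maxwellian of temperature `θr`. -/
def refOneBody (θr : ℝ) : Measure (T3 × V3) :=
  (volume : Measure T3).prod
    ((volume : Measure V3).withDensity fun v => ENNReal.ofReal (localMaxwellian 1 θr (0 : V3) v))

/-- **Free a-priori fact (to be proved, M-sized): N-uniform entropy bound for the mean one-body
marginal along the true flow.**  Liouville keeps `H(law_s ‖ G_N) = H(λ_N ‖ G_N) = O(N)` for the
homogeneous Gibbs law `G_N`; `G_N` is `e^{O(φ N)}`-comparable to the product law (uniform ⊗ Maxwellian);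
superadditivity of relative entropy over the `N+1` exchangeable one-body marginals then gives a bound
on the particle-`0` marginal that does not depend on `N`, on the flow, or on the time `s`.  Consequence:
no concentration of the mean marginal (uniform integrability at the `L log L` level) at every time —
the regularity needed to even pose the near-Maxwellian Grönwall of the line; it does NOT give cubic
tails (those stay a separate stub). -/
def MeanMarginalEntropyBound : Prop :=
  Continuous a₀ → Continuous θ₀ → Continuous u₀ → (∀ x, 0 < a₀ x) → (∀ x, 0 < θ₀ x) →
    ∃ σ₀ : ℝ, 0 < σ₀ ∧ ∀ σ' : ℝ, 0 < σ' → σ' < σ₀ →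
      ∃ C θr : ℝ, 0 < θr ∧ ∀ (Φ : Flows σ') (N : ℕ) (s : ℝ), 0 ≤ s →
        InformationTheory.klDiv (meanOneBodyMarginal σ' a₀ θ₀ u₀ Φ N s) (refOneBody θr)
          ≤ ENNReal.ofReal C

/-! ## §4 Shape of the crux input: Kato margin on the J-odd incoming contact defect -/

/-- The mark space `(t, x, ω, v⁻, v_*⁻)` of the tree's collision measure. -/
abbrev Mark : Type := ℝ × T3 × V3 × V3 × V3

/-- The **inverse-collision involution `J`** on marks: `(t, x, ω, v, w) ↦ (t, x, -ω, v', w')` with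
`(v', w') = reflectVel ω (v, w)`; it preserves the flux measure `((w - v)·ω)₊` and the one-body
collision bracket `h(v') + h(w') - h(v) - h(w)` is `J`-odd, so the first BBGKY equation of the mean
marginal sees ONLY the `J`-odd part of the incoming contact law (route JParityClosure's parity split). -/
def markJ (m : Mark) : Mark :=
  (m.1, m.2.1, -m.2.2.1, (reflectVel m.2.2.1 (m.2.2.2.1, m.2.2.2.2)).1,
    (reflectVel m.2.2.1 (m.2.2.2.1, m.2.2.2.2)).2)

/-- The **mean collision statistic** of a mark functional `Ψ` over the time window `W`, along the flow
started from the local Gibbs law, normalised by the number of collisions `≍ (N+1)^{4/3}` per unit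
macroscopic time. -/
def meanCollisionStat (Φ : Flows σ) (N : ℕ) (W : Set ℝ) (Ψ : Mark → ℝ) : ℝ :=
  ((N : ℝ) + 1) ^ (-(4 / 3 : ℝ)) *
    ∫ z, collisionSum (Torus.geometry (Fin 3)) (hsDiameter σ N) (fun t => (Φ N).flow t z) W
      (fun c => Ψ c.mark) ∂(localGibbsLaw σ a₀ u₀ θ₀ N (Φ N))

/-- The **Euler local-Maxwellian one-body law** at macroscopic time `s`: density `ρ_s(x)` in position
times the Maxwellian `M_{u_s(x), θ_s(x)}` in velocity (the leading term of the Hilbert expansion of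
Caflisch 1980 / Guo–Jiang–Jang 2009 around the classical solution). -/
def eulerOneBody (ρ θ : ℝ → T3 → ℝ) (u : ℝ → T3 → V3) (s : ℝ) : Measure (T3 × V3) :=
  ((volume : Measure T3).prod (volume : Measure V3)).withDensity
    fun y => ENNReal.ofReal (localMaxwellian (ρ s y.1) (θ s y.1) (u s y.1) y.2)

/-- The **mean one-body deviation** at time `s`: relative entropy of the mean one-body marginal of the
true law with respect to the Euler local-Maxwellian law (the crux-plan seat may replace `klDiv` by the
polynomially weighted `L²`/`L¹` distance of the Caflisch–Guo remainder estimate; the SHAPE is the same). -/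
def meanDev (Φ : Flows σ) (ρ θ : ℝ → T3 → ℝ) (u : ℝ → T3 → V3) (N : ℕ) (s : ℝ) : ℝ :=
  (InformationTheory.klDiv (meanOneBodyMarginal σ a₀ θ₀ u₀ Φ N s) (eulerOneBody ρ θ u s)).toReal

/-- **Shape of the crux input `ContactDefectMargin` (Kato margin on the J-odd incoming contact defect).**
Parameters left to the crux-plan seat: `chaos Φ N W Ψ` = the value of the statistic predicted by the
Enskog-chaotic incoming law `Y(φ)·F¹⊗F¹·flux` built on the mean marginal (thermodynamic contact value
`Y = (3/2π)·hsExcessFreeEnergy′`), `gap` = the linearised hard-sphere spectral gap in the chosen weighted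
space (`hardSphereLinearizedOp_spectralGap`, proved in tree in `L²(M)`), `wt` = the admissible growth of
test marks.  The statement: there is a margin `κ < 1` and a packing threshold such that, along every
guarded classical solution tied at `t = 0`, for every bounded `J`-ODD mark functional `Ψ` and every
window `[s, s + h]`, the mean statistic differs from its chaotic prediction by at most
`κ · gap · h · sup_{s' ≤ s + h} meanDev s'` plus a vanishing error — a RATIO bound with room, not a limit. -/
def ContactDefectMarginShape (chaos : Flows σ → ℕ → Set ℝ → (Mark → ℝ) → ℝ) (gap : ℝ)
    (wt : Mark → ℝ) : Prop :=
  ∃ κ : ℝ, 0 ≤ κ ∧ κ < 1 ∧ ∃ η : ℝ, 0 < η ∧ ∃ σ₀ : ℝ, 0 < σ₀ ∧ (0 < σ → σ < σ₀ →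
    ∀ (T : ℝ) (ρ θ : ℝ → T3 → ℝ) (u : ℝ → T3 → V3), IsHardSphereEulerSolution σ T ρ u θ →
      (∀ t ∈ Ico 0 T, ∀ x, ρ t x * σ ^ 3 < η) →
      ∀ Φ : Flows σ, TendstoHydroFieldsAt (fun N => localGibbsLaw σ a₀ u₀ θ₀ N (Φ N)) Φ ρ u θ 0 →
        ∀ t ∈ Ico 0 T, ∃ err : ℕ → ℝ, Tendsto err atTop (𝓝 0) ∧
          ∀ (N : ℕ) (Ψ : Mark → ℝ), (∀ m, Ψ (markJ m) = -Ψ m) → (∀ m, |Ψ m| ≤ wt m) →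
            ∀ s h : ℝ, 0 ≤ s → 0 < h → s + h ≤ t →
              |meanCollisionStat σ a₀ θ₀ u₀ Φ N (Icc s (s + h)) Ψ - chaos Φ N (Icc s (s + h)) Ψ|
                ≤ κ * gap * h * sSup ((meanDev σ a₀ θ₀ u₀ Φ ρ θ u N) '' Icc 0 (s + h)) + h * err N)

/-! ## §5 The free H-budget of the mean marginal and the production-units margin (consumer B) -/

/-- **Boltzmann entropy of the mean one-body marginal** at time `s`: `S(F¹_N(s)) = -∫ F log F`, written as
minus the relative entropy with respect to Lebesgue measure on `𝕋³ × ℝ³`. -/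
def meanEntropy (Φ : Flows σ) (N : ℕ) (s : ℝ) : ℝ :=
  -(InformationTheory.klDiv (meanOneBodyMarginal σ a₀ θ₀ u₀ Φ N s)
      ((volume : Measure T3).prod (volume : Measure V3))).toReal

/-- **Free entropy ceiling (to be proved, S-sized).** Exchangeability and exact energy conservation pin the
second velocity moment of the mean marginal to the (conserved) energy per particle, so its Boltzmann entropy
is bounded above by that of the Maxwellian with the same energy — uniformly in the flow, `N` and `s`. -/
def MeanEntropyCeiling : Prop :=
  Continuous a₀ → Continuous θ₀ → Continuous u₀ → (∀ x, 0 < a₀ x) → (∀ x, 0 < θ₀ x) →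
    ∃ σ₀ : ℝ, 0 < σ₀ ∧ ∀ σ' : ℝ, 0 < σ' → σ' < σ₀ →
      ∃ C : ℝ, ∀ (Φ : Flows σ') (N : ℕ) (s : ℝ), 0 ≤ s → meanEntropy σ' a₀ θ₀ u₀ Φ N s ≤ C

/-- **Consumer B is algebra (proved).** If the time-integrated chaotic production `P ≥ 0` and the
time-integrated J-odd source `Sa` satisfy the exact H-budget `P - Sa ≤ C₀` (entropy ceiling minus initial
entropy) and the production-units margin `Sa ≤ (1 - δ) * P + E` with `0 < δ`, then `P ≤ (C₀ + E) / δ`.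
With `P = ∫_0^{ν_N t} 𝒫` this makes the kinetic-time AVERAGE production `O(1/(δ ν_N t)) → 0`. -/
theorem int_prod_le_of_margin {P Sa C₀ E δ : ℝ} (hδ : 0 < δ)
    (hbudget : P - Sa ≤ C₀) (hmargin : Sa ≤ (1 - δ) * P + E) :
    P ≤ (C₀ + E) / δ := by
  rw [le_div_iff₀ hδ]
  nlinarith

/-- **Shape of the production-units margin (consumer B's crux input).**  `prod Φ N τ₁ τ₂` = the chaotic
(Enskog, thermodynamic contact value) entropy production of the mean marginal integrated over kinetic times
`[τ₁, τ₂]`; `src Φ N τ₁ τ₂` = the J-odd source `½∫Δ_a·L·flux` integrated likewise (by Cauchy–Schwarz with the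
logarithmic-mean weight it is at most `‖Δ_a‖_{Λ⁻¹}·√(prod / Y)`, so the margin below follows from a weighted-L²
bound on the J-odd defect by `(1-δ)√Y` times the root production).  Both functionals are parameters here. -/
def DefectProductionMarginShape (prod src : Flows σ → ℕ → ℝ → ℝ → ℝ) : Prop :=
  ∃ δ : ℝ, 0 < δ ∧ ∃ η : ℝ, 0 < η ∧ ∃ σ₀ : ℝ, 0 < σ₀ ∧ (0 < σ → σ < σ₀ →
    ∀ (T : ℝ) (ρ θ : ℝ → T3 → ℝ) (u : ℝ → T3 → V3), IsHardSphereEulerSolution σ T ρ u θ →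
      (∀ t ∈ Ico 0 T, ∀ x, ρ t x * σ ^ 3 < η) →
      ∀ Φ : Flows σ, TendstoHydroFieldsAt (fun N => localGibbsLaw σ a₀ u₀ θ₀ N (Φ N)) Φ ρ u θ 0 →
        ∀ t ∈ Ico 0 T, ∃ C : ℝ, ∃ err : ℕ → ℝ, Tendsto err atTop (𝓝 0) ∧ ∀ N : ℕ,
          src Φ N 0 (σ ^ 2 * ((N : ℝ) + 1) ^ (1 / 3 : ℝ) * t)
            ≤ (1 - δ) * prod Φ N 0 (σ ^ 2 * ((N : ℝ) + 1) ^ (1 / 3 : ℝ) * t) + C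
              + err N * (σ ^ 2 * ((N : ℝ) + 1) ^ (1 / 3 : ℝ) * t))

end Summit.AtomisticToContinuum.HydrodynamicLimit.Cruxes.HydroLimitProfilewiseBand.Ideator2

end
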